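import Literature.MathematicalPhysics.QuantumFieldTheory.Balaban1983to89.B12Transverse536

/-!
# `Balaban1983to89.B12WardLeadingForm` — [Balaban1987RG1] §5, AUDIT REMARK: the printed leading form
`β(δ_{μν}Δ(p) − \overline{∂_μ(p)}∂_ν(p))` of (5.16)/(5.36)/(5.37) satisfies the Ward identities (5.15)/(5.21) only
modulo third order; its TRANSPOSE is the exactly transverse form (kernel certificate of a located imprecision)

CITATION HEADER (lean-in-tree rule 2026-08-18).  Source: T. Bałaban, *Renormalization group approach to lattice
gauge field theories. I.*, Commun. Math. Phys. **109**, 249–301 (1987), doi:10.1007/bf01215223 [Balaban1987RG1]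
(held: `paper:balaban1987-cmp109-rg-i-small-field`; journal page = PDF page + 248).  Displays re-read on the
300-dpi renders of p. 293 [PDF 45], p. 294 [46], p. 297 [49]
(`HOME/b2b-balaban-ref1/pages/1987-cmp109-rg-I-small-field/…-p045-x2.png`, `…-p046-x2.png`, `…-p049-x2.png`).
Audit cell `pub-balaban`, unit `b2b-balaban-b03-g6` (B12 §§2–5 lineage), node B12-WARD-LEADING; sits on top of
`…B12Rep537` (the kernel `wilsonQ`, its symbol `genFun_wilsonQ`, its moments) and `…B12Transverse536` (`WardB`).
Value = a kernel-checked LOCATED IMPRECISION in print, classified harmless below; NOT summit progress; nothing about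
the sign or size of β.

THE PRINTED TEXT (verbatim).  NOTATION (v1.1, DOCFIX G-ref5-91 class, self-applied): the print writes Π_{μν}(p), Π_{μν}(ζ), Π′_{μν}(p) WITHOUT a tilde for
the momentum-space function of (5.11) (renders p045/p049/p050 re-read as images); inside quotation marks this header now
follows the print exactly; OUTSIDE quotation marks Π̃, Π̃′ (tilde ours) denote the momentum-space functions, to keep them
apart from the position-space kernel Π_{μν}(x).  v1 → v1.1: docstrings only; every Lean declaration byte-unchanged.
* p. 293: (5.15) "Σ_μ ∂_μ(−ζ)Π_{μν}(ζ) = Σ_ν ∂_ν(ζ)Π_{μν}(ζ) = 0, where ∂_μ(ζ) = e^{iζ_μ} − 1."; (5.16) "Π_{μν}(p) =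
  β(δ_{μν}Δ(p) − \overline{∂_μ(p)}∂_ν(p)) + (terms of higher orders in derivatives ∂(p), \overline{∂(p)})".
* p. 294: (5.17) "f_{μν}(z₁, …, z_d) = Π_{μν}((1/i)log z₁, …, (1/i)log z_d), e^{−δ₁} < |z_μ| < e^{δ₁}" [so
  `z_μ = e^{iζ_μ}`]; (5.21) "Σ_μ (z_μ⁻¹ − 1)f_{μν}(z) = Σ_ν (z_ν − 1)f_{μν}(z) = 0."
* p. 297: (5.36) "f_{μν}(z) = β(δ_{μν}Σ_κ(z_κ⁻¹ − 1)(z_κ − 1) − (z_μ⁻¹ − 1)(z_ν − 1)) + …"; (5.37) "Π_{μν}(p) =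
  β(δ_{μν}Δ(p) − \overline{∂_μ(p)}∂_ν(p)) + Π′_{μν}(p).  The function Π′_{μν}(p) has all the symmetries of the
  function Π_{μν}(p) and it can be written in the form of a third order polynomial in the derivatives
  \overline{∂(p)}, ∂(p),"; (5.43) "Σ Π_{μν}(x − y) tr δB_μ(x)B_ν(y) = β½Σ_{x,μ,ν} tr(∂δB)_{μν}(x)(∂B)_{μν}(x) + …".

DICTIONARY (as in `B12Rep537`): generating function `Σ_x c(x)wˣ` (`PeriodicGleason.genFun`), `w = e^{−iζ} = z⁻¹`;
backward difference `Δ*_μ` (`PeriodicGleason.delta μ`) ↔ multiplication by `w_μ − 1 = z_μ⁻¹ − 1 = ∂_μ(−ζ)`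
(= `\overline{∂_μ(p)}` for real p); forward difference `Δ_ν` (`B12Rep537.fdelta ν`) ↔ `w_ν⁻¹ − 1 = z_ν − 1 = ∂_ν(ζ)`.
Hence: the printed leading form of (5.16)/(5.36)/(5.37) is `β · wilsonQ μ ν`
(`wilsonQ μ ν = δ_{μν}Σ_κΔ*_κΔ_κδ − Δ*_μΔ_νδ`, symbol certified in `B12Rep537.genFun_wilsonQ`); (5.15)₁ = (5.21)₁ is
`WardB` (`Σ_μ Δ*_μF_{μν} = 0`, `B12Transverse536`); (5.15)₂ = (5.21)₂ is `WardB₂` below (`Σ_ν Δ_νF_{μν} = 0`).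

THE FINDING.  (a) `not_wardB_wilsonQ`, `not_wardB₂_wilsonQ`: for `d ≥ 2` the printed family `(wilsonQ μ ν)` violates
BOTH identities (5.15)/(5.21) — indeed `Σ_μ Δ*_μ wilsonQ_{μν}(e_ν) = 2(d − 1)` (`sum_delta_wilsonQ_unitVec`); on the
symbol side `Σ_μ (z_μ⁻¹ − 1)[δ_{μν}Δ − (z_μ⁻¹ − 1)(z_ν − 1)] = (z_ν⁻¹ − 1)Δ − (z_ν − 1)Σ_μ(z_μ⁻¹ − 1)² ≢ 0`.
(b) `wardB_wilsonQ_transpose`, `wardB₂_wilsonQ_transpose`: the TRANSPOSED family `(wilsonQ ν μ)`, symbol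
`δ_{μν}Δ(ζ) − ∂_μ(ζ)∂_ν(−ζ)` = "`δ_{μν}Δ(p) − ∂_μ(p)\overline{∂_ν(p)}`", satisfies both identities EXACTLY (all
difference operators commute).  (c) `wilsonQ_transpose_sub`: the two differ by the explicit THIRD-ORDER kernel
`wilsonQ ν μ − wilsonQ μ ν = Δ*_μΔ*_νΔ_μδ − Δ*_μΔ*_νΔ_νδ` (symbol `(w_μ−1)(w_ν−1)[(w_μ⁻¹−1) − (w_ν⁻¹−1)]`, entire
coefficients), and (d) `taylorData3_wilsonQ_transpose`: they have the SAME Taylor data to second order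
(`B12Rep537.TaylorData3 β μ ν (β · wilsonQ ν μ)`), so every statement "up to third-order terms" — (5.16), (5.36),
the representation (5.37)/(5.38) with (5.44), the value (5.42) of β, and the cell's certificates `B12Rep537.rep538`,
`B12Transverse536.taylorData3_of_symmetries` — is INSENSITIVE to the choice.  (e) `wilsonQ_neg`: `wilsonQ μ ν (−x) =
wilsonQ ν μ x`, i.e. both forms obey (5.14)/(5.20) `Π̃_{μν}(ζ) = Π̃_{νμ}(−ζ)`, and `wardB₂_iff_wardB` reduces the second
identity to the first under this inversion.

CLASSIFICATION (cell taxonomy: located imprecision, class M, non-blocking).  With the bars placed as printed, the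
remainder `Π̃′ := Π̃ − β·(printed form)` of (5.37) does NOT satisfy (5.15) when `β ≠ 0` (by (a), since Π̃ does), contrary to the
sentence "The function Π′_{μν}(p) has all the symmetries of the function Π_{μν}(p)"; with the transposed form
`β(δ_{μν}Δ(p) − ∂_μ(p)\overline{∂_ν(p)})` it does (by (b)), and this is also the form that (5.43) requires: under the
pairing (5.11), `Σ_{x,y}Π_{μν}(x−y)a_μ(x)b_ν(y) = ∫ \overline{ã_μ(p)} Π̃_{μν}(p) b̃_ν(p)`, and
`½Σ_x Σ_{μν}(∂_μa_ν − ∂_νa_μ)(∂_μb_ν − ∂_νb_μ) = ∫ Σ_{μν} \overline{ã_μ}[δ_{μν}Δ − ∂_μ\overline{∂_ν}] b̃_ν`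
(forward lattice derivatives, `(∂_μf)~ = ∂_μ(p)f̃`).  Every USE in B12 (pp. 297–298: (5.38), the analyticity of the
coefficients, (5.44), "the first and second order derivatives of the function Π′_{μν}(p) vanish at p = 0", the
cancellations against (4.42)/(4.44)) depends only on the second-order Taylor data and is unaffected by (d); the
discrepancy (c) is one more "irrelevant" third-order term of (5.43).  So: read (5.16)/(5.36)/(5.37) with
`∂_μ(p)\overline{∂_ν(p)}` (equivalently `(z_μ − 1)(z_ν⁻¹ − 1)` in (5.36)); nothing downstream changes.
-/

namespace Literature.MathematicalPhysics.QuantumFieldTheory.Balaban1983to89.B12WardLeadingForm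

noncomputable section

open Literature.MathematicalPhysics.QuantumFieldTheory.GawedzkiKupiainen1985.PeriodicGleason
open Literature.MathematicalPhysics.QuantumFieldTheory.Balaban1983to89.B12Rep537
open Literature.MathematicalPhysics.QuantumFieldTheory.Balaban1983to89.B12Transverse536

variable {d : ℕ}

/-! ## The second Ward identity and the inversion symmetry (5.14)/(5.20) -/

/-- **(5.15)₂/(5.21)₂ typed** for a family of complex kernels: `Σ_ν Δ_νF_{μν} = 0` (forward difference on the second
index; symbol side `Σ_ν ∂_ν(ζ)Π̃_{μν}(ζ) = 0`, `Σ_ν (z_ν − 1)f_{μν}(z) = 0`).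
[cite: Balaban1987RG1, (5.9)/(5.15) p.293, (5.21) p.294] -/
def WardB₂ (F : Fin d → Fin d → Pt d → ℂ) : Prop := ∀ μ x, ∑ ν, fdelta ν (F μ ν) x = 0

/-- `δ₀` is even. [folklore] -/
theorem dirac_neg (x : Pt d) : dirac (-x) = dirac x := by
  unfold dirac; simp only [neg_eq_zero]

/-- `Δ*_μΔ_νδ₀(−x) = Δ*_νΔ_μδ₀(x)`. [folklore] -/
theorem crossQ_neg (μ ν : Fin d) (x : Pt d) : crossQ μ ν (-x) = crossQ ν μ x := by
  rw [crossQ_apply, crossQ_apply]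
  have e1 : -x + (unitVec ν - unitVec μ) = -(x + (unitVec μ - unitVec ν)) := by abel
  have e2 : -x + -unitVec μ = -(x + unitVec μ) := by abel
  have e3 : -x + unitVec ν = -(x + -unitVec ν) := by abel
  have e4 : -x + (0 : Pt d) = -(x + 0) := by abel
  simp only [e1, e2, e3, e4, dirac_neg]; ring

/-- **(5.14)/(5.20) for the leading form**: `Q_{μν}(−x) = Q_{νμ}(x)` (`Π̃_{μν}(ζ) = Π̃_{νμ}(−ζ)`, `f_{μν}(z) = f_{νμ}(z⁻¹)`).
[cite: Balaban1987RG1, (5.8)/(5.14) p.293, (5.20) p.294] -/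
theorem wilsonQ_neg (μ ν : Fin d) (x : Pt d) : wilsonQ μ ν (-x) = wilsonQ ν μ x := by
  unfold wilsonQ
  rw [crossQ_neg]
  by_cases h : μ = ν
  · subst h; simp only [if_true, crossQ_neg]
  · rw [if_neg h, if_neg (Ne.symm h)]

/-- The second Ward identity of `F` is the first Ward identity of the inverted transpose `(μ,ν,x) ↦ F_{νμ}(−x)`
(under (5.14) `Π_{μν}(x) = Π_{νμ}(−x)` the two identities of (5.9)/(5.15) are equivalent). [folklore] -/
theorem wardB₂_iff_wardB (F : Fin d → Fin d → Pt d → ℂ) :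
    WardB₂ F ↔ WardB fun μ ν x => F ν μ (-x) := by
  have key : ∀ μ x, ∑ ν, fdelta ν (F μ ν) x = ∑ ν, delta ν (fun y => F μ ν (-y)) (-x) := by
    intro μ x
    refine Finset.sum_congr rfl fun ν _ => ?_
    have e : -(-x - unitVec ν) = x + unitVec ν := by abel
    simp only [fdelta, delta, neg_neg, e]
  constructor
  · intro h ν x
    have := h ν (-x)
    rw [key, neg_neg] at this
    exact this
  · intro h μ x
    rw [key]; exact h μ (-x)

/-! ## Commutation of lattice differences -/

/-- `Δ*_μΔ*_κ = Δ*_κΔ*_μ`. [folklore] -/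
theorem delta_comm (μ κ : Fin d) (g : Pt d → ℂ) : delta μ (delta κ g) = delta κ (delta μ g) := by
  funext x; simp only [delta, sub_right_comm]; ring

/-- `Δ*_μΔ_κ = Δ_κΔ*_μ`. [folklore] -/
theorem delta_fdelta_comm (μ κ : Fin d) (g : Pt d → ℂ) : delta μ (fdelta κ g) = fdelta κ (delta μ g) := by
  funext x; simp only [delta, fdelta, add_sub_right_comm]; ring

/-- `Δ*_μ` of a finite sum of functions. [folklore] -/
theorem delta_finsum {ι : Type*} (μ : Fin d) (s : Finset ι) (f : ι → Pt d → ℂ) (x : Pt d) :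
    delta μ (fun y => ∑ i ∈ s, f i y) x = ∑ i ∈ s, delta μ (f i) x := by
  simp only [delta, ← Finset.sum_sub_distrib]

/-! ## (b) The transposed form is exactly transverse -/

/-- **The TRANSPOSED leading form satisfies (5.15)₁/(5.21)₁ exactly**: `Σ_μ Δ*_μ Q_{νμ} = 0`
(symbol: `Σ_μ ∂_μ(−ζ)[δ_{μν}Δ − ∂_μ(ζ)∂_ν(−ζ)] = ∂_ν(−ζ)Δ − ∂_ν(−ζ)Δ = 0`).
[cite: Balaban1987RG1, (5.15) p.293, (5.21) p.294, (5.36)–(5.37) p.297] -/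
theorem wardB_wilsonQ_transpose : WardB fun μ ν => (wilsonQ ν μ : Pt d → ℂ) := by
  intro ν x
  have e : ∀ μ, delta μ (wilsonQ ν μ) x =
      (if ν = μ then delta μ (fun y => ∑ κ, crossQ κ κ y) x else 0) - delta ν (crossQ μ μ) x := by
    intro μ
    have hc : delta μ (crossQ ν μ) = delta ν (crossQ μ μ) := by
      unfold crossQ; rw [delta_comm]
    have : delta μ (wilsonQ ν μ) x = delta μ (fun y => (if ν = μ then ∑ κ, crossQ κ κ y else 0)) x -
        delta μ (crossQ ν μ) x := by
      simp only [delta, wilsonQ]; ring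
    rw [this, hc]
    by_cases h : ν = μ
    · simp only [if_pos h]
    · simp only [if_neg h, delta, sub_self]
  simp only [e, Finset.sum_sub_distrib, Finset.sum_ite_eq, Finset.mem_univ, if_true, delta_finsum, sub_self]

/-- **… and (5.15)₂/(5.21)₂ exactly**: `Σ_ν Δ_ν Q_{νμ} = 0` for every `μ`, i.e. `WardB₂ (μ ν ↦ Q_{νμ})` (via the inversion
symmetry `wilsonQ_neg` and `wardB₂_iff_wardB`).
[cite: Balaban1987RG1, (5.15) p.293, (5.21) p.294] -/
theorem wardB₂_wilsonQ_transpose : WardB₂ fun μ ν => (wilsonQ ν μ : Pt d → ℂ) := by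
  rw [wardB₂_iff_wardB]
  simp only [wilsonQ_neg]
  exact wardB_wilsonQ_transpose

/-! ## (a) The printed form is not exactly transverse -/

/-- `δ₀` vanishes at a lattice point with a non-zero coordinate. [folklore] -/
theorem dirac_eq_zero_of_apply {x : Pt d} (j : Fin d) (h : x j ≠ 0) : dirac x = 0 := by
  unfold dirac; rw [if_neg]; intro hx; exact h (by rw [hx]; rfl)

/-- `δ₀(0) = 1`. [folklore] -/
theorem dirac_zero : dirac (0 : Pt d) = 1 := if_pos rfl

/-- `Δ*_μΔ_μδ₀(0) = 2`. [folklore] -/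
theorem crossQ_self_zero (μ : Fin d) : crossQ μ μ (0 : Pt d) = 2 := by
  rw [crossQ_apply]
  simp only [sub_self, add_zero, zero_add, dirac_zero]
  rw [dirac_eq_zero_of_apply (x := -unitVec μ) μ (by simp [unitVec]),
    dirac_eq_zero_of_apply (x := unitVec μ) μ (by simp [unitVec])]
  norm_num

/-- `Δ*_μΔ_μδ₀(e_ν) = 0` for `μ ≠ ν`. [folklore] -/
theorem crossQ_self_unitVec {μ ν : Fin d} (h : μ ≠ ν) : crossQ μ μ (unitVec ν : Pt d) = 0 := by
  rw [crossQ_apply]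
  simp only [sub_self, add_zero]
  rw [dirac_eq_zero_of_apply (x := unitVec ν) ν (by simp [unitVec]),
    dirac_eq_zero_of_apply (x := unitVec ν + -unitVec μ) ν (by simp [unitVec, h.symm]),
    dirac_eq_zero_of_apply (x := unitVec ν + unitVec μ) ν (by simp [unitVec, h.symm])]
  norm_num

/-- `Δ*_μ(Δ*_μΔ_νδ₀)(e_ν) = 0` for `μ ≠ ν`. [folklore] -/
theorem delta_crossQ_unitVec {μ ν : Fin d} (h : μ ≠ ν) : delta μ (crossQ μ ν) (unitVec ν : Pt d) = 0 := by
  simp only [delta, crossQ_apply, add_zero]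
  have z : ∀ v : Pt d, v ν ≠ 0 → dirac v = 0 := fun v hv => dirac_eq_zero_of_apply ν hv
  rw [z (unitVec ν - unitVec μ + (unitVec ν - unitVec μ)) (by simp [unitVec, h.symm]),
    z (unitVec ν - unitVec μ + -unitVec μ) (by simp [unitVec, h.symm]),
    z (unitVec ν - unitVec μ + unitVec ν) (by simp [unitVec, h.symm]),
    z (unitVec ν - unitVec μ) (by simp [unitVec, h.symm]),
    z (unitVec ν + (unitVec ν - unitVec μ)) (by simp [unitVec, h.symm]),
    z (unitVec ν + -unitVec μ) (by simp [unitVec, h.symm]),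
    z (unitVec ν + unitVec ν) (by simp [unitVec]),
    z (unitVec ν) (by simp [unitVec])]
  norm_num

/-- **The divergence of the printed form at `e_ν`**: `Σ_μ Δ*_μ Q_{μν}(e_ν) = 2(d − 1)`.
[cite: Balaban1987RG1, (5.15)–(5.16) p.293, (5.36)–(5.37) p.297] -/
theorem sum_delta_wilsonQ_unitVec (ν : Fin d) :
    ∑ μ, delta μ (wilsonQ μ ν) (unitVec ν : Pt d) = 2 * ((d : ℂ) - 1) := by
  -- rearrangement `Σ_μ Δ*_μQ_{μν} = Σ_μ [Δ*_ν(Δ*_μΔ_μδ) − Δ*_μ(Δ*_μΔ_νδ)]`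
  have e : ∀ x : Pt d, ∑ μ, delta μ (wilsonQ μ ν) x =
      ∑ μ, (delta ν (crossQ μ μ) x - delta μ (crossQ μ ν) x) := by
    intro x
    have h1 : ∀ μ, delta μ (wilsonQ μ ν) x = (if μ = ν then delta μ (fun y => ∑ κ, crossQ κ κ y) x else 0) -
        delta μ (crossQ μ ν) x := by
      intro μ
      have : delta μ (wilsonQ μ ν) x = delta μ (fun y => (if μ = ν then ∑ κ, crossQ κ κ y else 0)) x -
          delta μ (crossQ μ ν) x := by
        simp only [delta, wilsonQ]; ring
      rw [this]
      by_cases h : μ = ν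
      · simp only [if_pos h]
      · simp only [if_neg h, delta, sub_self]
    simp only [h1, Finset.sum_sub_distrib, Finset.sum_ite_eq', Finset.mem_univ, if_true, delta_finsum]
  rw [e, ← Finset.add_sum_erase _ _ (Finset.mem_univ ν), sub_self, zero_add]
  have h2 : ∀ μ ∈ Finset.univ.erase ν, delta ν (crossQ μ μ) (unitVec ν : Pt d) - delta μ (crossQ μ ν) (unitVec ν) = 2 := by
    intro μ hμ
    have h : μ ≠ ν := Finset.ne_of_mem_erase hμ
    rw [delta_crossQ_unitVec h, sub_zero]
    simp only [delta, sub_self, crossQ_self_zero, crossQ_self_unitVec h, sub_zero]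
  rw [Finset.sum_congr rfl h2, Finset.sum_const, Finset.card_erase_of_mem (Finset.mem_univ ν),
    Finset.card_univ, Fintype.card_fin, nsmul_eq_mul]
  rw [Nat.cast_sub (Fin.pos ν)]
  push_cast; ring

/-- **The printed leading form violates the first Ward identity (5.15)₁/(5.21)₁** (`d ≥ 2`).
[cite: Balaban1987RG1, (5.15)–(5.16) p.293, (5.21) p.294, (5.36)–(5.37) p.297] -/
theorem not_wardB_wilsonQ (hd : 2 ≤ d) : ¬ WardB fun μ ν => (wilsonQ μ ν : Pt d → ℂ) := by
  intro h
  have h0 : ∑ μ, delta μ (wilsonQ μ (⟨0, by omega⟩ : Fin d)) (unitVec ⟨0, by omega⟩) = 0 := h _ _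
  rw [sum_delta_wilsonQ_unitVec] at h0
  have : (2 : ℂ) * ((d : ℂ) - 1) ≠ 0 := by
    apply mul_ne_zero two_ne_zero
    rw [sub_ne_zero]; exact_mod_cast (show d ≠ 1 by omega)
  exact this h0

/-- **… and the second one (5.15)₂/(5.21)₂** (`d ≥ 2`). [cite: Balaban1987RG1, (5.15) p.293, (5.21) p.294] -/
theorem not_wardB₂_wilsonQ (hd : 2 ≤ d) : ¬ WardB₂ fun μ ν => (wilsonQ μ ν : Pt d → ℂ) := by
  rw [wardB₂_iff_wardB]
  simp only [wilsonQ_neg]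
  exact not_wardB_wilsonQ hd

/-! ## (c), (d) The discrepancy is third order and invisible to the Taylor data of order ≤ 2 -/

/-- **The two forms differ by an explicit third-order difference kernel**:
`Q_{νμ} − Q_{μν} = Δ*_μΔ*_νΔ_μδ₀ − Δ*_μΔ*_νΔ_νδ₀` (symbol `(w_μ − 1)(w_ν − 1)[(w_μ⁻¹ − 1) − (w_ν⁻¹ − 1)]`).
[cite: Balaban1987RG1, (5.37)–(5.38) p.297] -/
theorem wilsonQ_transpose_sub (μ ν : Fin d) (x : Pt d) :
    wilsonQ ν μ x - wilsonQ μ ν x =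
      delta μ (delta ν (fdelta μ dirac)) x - delta μ (delta ν (fdelta ν dirac)) x := by
  by_cases h : μ = ν
  · subst h; simp
  have lhs : wilsonQ ν μ x - wilsonQ μ ν x = crossQ μ ν x - crossQ ν μ x := by
    unfold wilsonQ; rw [if_neg h, if_neg (Ne.symm h)]; ring
  rw [lhs]
  simp only [crossQ, delta, fdelta]
  have e1 : x - unitVec μ - unitVec ν + unitVec μ = x - unitVec ν := by abel
  have e2 : x - unitVec μ - unitVec ν + unitVec ν = x - unitVec μ := by abel
  rw [e1, e2]; simp only [sub_add_cancel]; ring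

/-- **Same Taylor data to second order**: the transposed form `β·Q_{νμ}` has exactly the power moments of order
`≤ 2` prescribed by `TaylorData3 β μ ν` (those of `β·Q_{μν}`), so every "up to third-order terms" statement of §5
is insensitive to the placement of the bars. [cite: Balaban1987RG1, (5.16) p.293, (5.36)–(5.37), (5.42) p.297] -/
theorem taylorData3_wilsonQ_transpose (β : ℂ) (μ ν : Fin d) :
    TaylorData3 β μ ν fun x => β * wilsonQ ν μ x := by
  refine taylorData3_of_moments ?_ ?_ ?_
  · show ∑' x : Pt d, β * wilsonQ ν μ x = 0
    rw [tsum_mul_left, tsum_wilsonQ, mul_zero]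
  · intro κ
    show ∑' x : Pt d, β * wilsonQ ν μ x * ((x κ : ℤ) : ℂ) = 0
    simp_rw [mul_assoc]; rw [tsum_mul_left, tsum_wilsonQ_mul_coord, mul_zero]
  · intro κ τ
    show ∑' x : Pt d, β * wilsonQ ν μ x * (((x κ : ℤ) : ℂ) * ((x τ : ℤ) : ℂ)) = _
    simp_rw [mul_assoc β]; rw [tsum_mul_left, tsum_wilsonQ_mul_coord2, kron_comm ν μ]; ring

/-- Consequently `TaylorData3` may be read with either form: a kernel has the Taylor data of `β·Q_{μν}` iff it has
those of `β·Q_{νμ}`. [cite: Balaban1987RG1, (5.16) p.293, (5.37) p.297] -/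
theorem taylorData3_iff_transpose (β : ℂ) (μ ν : Fin d) (P : Pt d → ℂ) :
    TaylorData3 β μ ν P ↔ ∀ γ : Fin d → ℕ, deg γ < 3 →
      ∑' x, P x * monom γ x = β * ∑' x, wilsonQ ν μ x * monom γ x := by
  have key : ∀ γ : Fin d → ℕ, deg γ < 3 →
      β * ∑' x, wilsonQ μ ν x * monom γ x = β * ∑' x, wilsonQ ν μ x * monom γ x := by
    intro γ hγ
    have h := taylorData3_wilsonQ_transpose β μ ν γ hγ
    simp_rw [mul_assoc β] at h
    rw [tsum_mul_left] at h
    exact h.symm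
  constructor
  · intro h γ hγ; rw [h γ hγ, key γ hγ]
  · intro h γ hγ; rw [h γ hγ, ← key γ hγ]

end

end Literature.MathematicalPhysics.QuantumFieldTheory.Balaban1983to89.B12WardLeadingForm
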